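import Mathlib
import HarnessLib

/-!
# The sample median is `s`-close whenever fewer than half of the values are `s`-far — the
# deterministic step that turns the row's "half of the estimates" certificates into statements
# about the median itself

HONEST FRAMING: exact (Metropolis-corrected) sampling algorithms for lattice gauge theory;
figures of merit are autocorrelation/cost numbers at stated couplings and volumes; no
continuum-physics claim.

Venture `LatticeQCDFlow` (cell pub-lqcd), topic `Scoring`; FANOUT row 8 (`s0-cpn-nemc`, GEN-17).
NEW WORK of the cell (elementary), not a published result; no definition is introduced.  The
median certificates of the row (`Scoring/ReplicaChains.lean`, `Scoring/SingleRunMedianOfBlocks.lean`,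
`Scoring/RegenerativeMedianOfGroups*.lean`) bound the probability of the event
"`#{k < K : s ≤ |A_k − c|} ≥ K/2`" and say IN WORDS that on its complement every sample median of
`A_0, …, A_{K−1}` is within `s` of `c`.  This file types that sentence: a MEDIAN of `K` reals
`y_0, …, y_{K−1}` is any `m` with at least `K/2` of the `y_k` at or above it and at least `K/2` at or
below it (every order-statistics median, and for even `K` every point between the two middle values,
qualifies); if fewer than `K/2` of the `y_k` satisfy `s ≤ |y_k − c|` then `|m − c| < s` (were
`m ≥ c + s`, the `≥ K/2` values above `m` would all be `s`-far; symmetrically below).  Consequently,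
for random `A_k` and ANY measurable selection of a median `M`, `{s ≤ |M − c|} ⊆ {K/2 ≤ #far}`, so
every bound of the row on the latter event is a bound on `P(s ≤ |M − c|)`.  Nothing is cited.

## Content (`y : ℕ → ℝ`, `K : ℕ`, `c s m : ℝ`; counts written as sums of `0/1` indicators over
## `Finset.range K`, the form used by the row's certificates)

* **`abs_median_sub_lt_of_count_lt`** — `K/2 ≤ Σ 1{m ≤ y_k}`, `K/2 ≤ Σ 1{y_k ≤ m}`,
  `Σ 1{s ≤ |y_k − c|} < K/2` ⇒ `|m − c| < s`;
* **`median_far_subset_count_ge`** — for functions `A k : α → ℝ` and `M : α → ℝ` that is pointwise a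
  median of `(A k ·)_{k<K}`: `{x | s ≤ |M x − c|} ⊆ {x | K/2 ≤ Σ_{k<K} 1{s ≤ |A k x − c|}}`;
  **`measureReal_median_far_le`** — hence `μ.real {s ≤ |M − c|} ≤ μ.real {K/2 ≤ #far}`.
-/

noncomputable section

namespace Summit.Ventures.LatticeQCDFlow.Scoring

open MeasureTheory Finset

/-- **A median is `s`-close when fewer than half the values are `s`-far.**  If at least `K/2` of the
`y_k` (`k < K`) are `≥ m`, at least `K/2` are `≤ m`, and fewer than `K/2` satisfy `s ≤ |y_k − c|`, then
`|m − c| < s`. -/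
theorem abs_median_sub_lt_of_count_lt (y : ℕ → ℝ) (K : ℕ) (c s m : ℝ)
    (hlo : (K : ℝ) / 2 ≤ ∑ k ∈ Finset.range K, (if m ≤ y k then (1 : ℝ) else 0))
    (hhi : (K : ℝ) / 2 ≤ ∑ k ∈ Finset.range K, (if y k ≤ m then (1 : ℝ) else 0))
    (hfar : ∑ k ∈ Finset.range K, (if s ≤ |y k - c| then (1 : ℝ) else 0) < (K : ℝ) / 2) :
    |m - c| < s := by
  by_contra h
  push Not at h
  rcases le_or_gt 0 (m - c) with hmc | hmc
  · -- `m − c ≥ s`: every value above `m` is far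
    rw [abs_of_nonneg hmc] at h
    have hle : ∑ k ∈ Finset.range K, (if m ≤ y k then (1 : ℝ) else 0)
        ≤ ∑ k ∈ Finset.range K, (if s ≤ |y k - c| then (1 : ℝ) else 0) := by
      refine Finset.sum_le_sum fun k _ => ?_
      by_cases hk : m ≤ y k
      · have : s ≤ |y k - c| := by
          rw [abs_of_nonneg (by linarith)]; linarith
        rw [if_pos hk, if_pos this]
      · rw [if_neg hk]; split_ifs <;> norm_num
    linarith
  · -- `c − m ≥ s`: every value below `m` is far
    rw [abs_of_neg hmc] at h
    have hle : ∑ k ∈ Finset.range K, (if y k ≤ m then (1 : ℝ) else 0)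
        ≤ ∑ k ∈ Finset.range K, (if s ≤ |y k - c| then (1 : ℝ) else 0) := by
      refine Finset.sum_le_sum fun k _ => ?_
      by_cases hk : y k ≤ m
      · have : s ≤ |y k - c| := by
          rw [abs_of_nonpos (by linarith)]; linarith
        rw [if_pos hk, if_pos this]
      · rw [if_neg hk]; split_ifs <;> norm_num
    linarith

variable {α : Type*}

/-- **As events**: for `A k : α → ℝ` and any `M : α → ℝ` that is, at every point, a median of
`A_0(x), …, A_{K−1}(x)`, the event "the median is `s`-far from `c`" is contained in "at least half of
the `A_k` are `s`-far". -/
theorem median_far_subset_count_ge (A : ℕ → α → ℝ) (M : α → ℝ) (K : ℕ) (c s : ℝ)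
    (hlo : ∀ x, (K : ℝ) / 2 ≤ ∑ k ∈ Finset.range K, (if M x ≤ A k x then (1 : ℝ) else 0))
    (hhi : ∀ x, (K : ℝ) / 2 ≤ ∑ k ∈ Finset.range K, (if A k x ≤ M x then (1 : ℝ) else 0)) :
    {x | s ≤ |M x - c|}
      ⊆ {x | (K : ℝ) / 2 ≤ ∑ k ∈ Finset.range K, (if s ≤ |A k x - c| then (1 : ℝ) else 0)} := by
  intro x hx
  simp only [Set.mem_setOf_eq] at hx ⊢
  by_contra h
  push Not at h
  have := abs_median_sub_lt_of_count_lt (fun k => A k x) K c s (M x) (hlo x) (hhi x) h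
  linarith

/-- **Hence every count certificate is a median certificate**: for any measure `μ`,
`μ.real {s ≤ |M − c|} ≤ μ.real {K/2 ≤ #{k < K : s ≤ |A_k − c|}}`. -/
theorem measureReal_median_far_le [MeasurableSpace α] (μ : Measure α) [IsFiniteMeasure μ]
    (A : ℕ → α → ℝ) (M : α → ℝ) (K : ℕ) (c s : ℝ)
    (hlo : ∀ x, (K : ℝ) / 2 ≤ ∑ k ∈ Finset.range K, (if M x ≤ A k x then (1 : ℝ) else 0))
    (hhi : ∀ x, (K : ℝ) / 2 ≤ ∑ k ∈ Finset.range K, (if A k x ≤ M x then (1 : ℝ) else 0)) :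
    μ.real {x | s ≤ |M x - c|}
      ≤ μ.real {x | (K : ℝ) / 2 ≤ ∑ k ∈ Finset.range K, (if s ≤ |A k x - c| then (1 : ℝ) else 0)} :=
  measureReal_mono (median_far_subset_count_ge A M K c s hlo hhi)

end Summit.Ventures.LatticeQCDFlow.Scoring

end
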